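import Mathlib
import Summits.Ventures.LatticeQCDFlow.TrivializingMaps.PolynomialForms
import HarnessLib

/-!
# Summing Lüscher's flow-action series, IV-b: the summed Wilson flow action is real-analytic near the field manifold

HONEST FRAMING: exact (Metropolis-corrected) sampling algorithms for lattice gauge theory; figures
of merit are autocorrelation/cost numbers at stated couplings and volumes; no continuum-physics claim.
Statements about Lüscher's construction for the SU(n) Wilson plaquette action on a FINITE periodic
lattice; the coupling window below (`|β| · n^8 θ₁ 3^5 ≤ 1`) does not depend on the lattice size.

M. Lüscher, CMP 293 (2010) 899–919 [Luscher2010Trivializing], §3.1/§4.2: the flow `Φ_t` of the gradient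
generator `Z_t = -∂S̃_t` (4.4) is built (§3.1, `FlowGlobalExistence`) from a generator that is `C¹` JOINTLY
in `(t, U)` on the ambient space `ℝ × M_n(ℂ)^E`, and the tree's unconditional form of §4.1
(`isTrivializingMap_of_flowEquation'`) wants the flow action `(t, W) ↦ S̃_t(W)` to be `C^∞` there.  File III
(`WilsonFlowActionSeries`) sums `S̃_t = ∑_k t^k β^{k+1} S̃^{(k)}` ON the field manifold; this file supplies
the ambient regularity WITHOUT any Sobolev theory: every term is a POLYNOMIAL in `(t, W)`
(`PolynomialForms`), so the series is a power series in the phase-space variable.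

* §4–§5 `|σ_k| = 4(k+1)`, so the forms `Gen.cmm` assemble into a formal power series whose radius is `≥ 3`
  as soon as `|β| n^8 θ₁(d,n,B) 3^5 ≤ 1` (THEOREM A's masses `N ≤ N₀ θ₁^k`; the volume enters the CONSTANT
  `#E`, never the RATE): `hasFPowerSeriesOnBall_series`; hence the sum is real-analytic, so `C^∞`, on the
  ball `‖q‖ < 3`, which contains `[-2,2] × SU(n)^E` (entries of unitary matrices have modulus `≤ 1`);
* §6–§7 a smooth bump (`ContDiffBump`, radii `2 < 5/2`) and the entrywise embedding of the Frobenius phase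
  space give a GLOBAL `C^∞` function `flowAction B β : ℝ → M_n(ℂ)^E → ℝ` which coincides with the series
  `∑_k t^k β^{k+1} S̃^{(k)}` for `|t| ≤ 2` on `SU(n)^E` (`contDiff_flowAction`, `flowAction_coeConfig`)
  — the input of file V (`StrongCouplingTrivializingMap`).

Authored by the pub-lqcd lean-2 seat (cell lqcd-flow, FANOUT row 31 GEN-4). Tags: [ours] = venture work.
-/

noncomputable section

namespace Summit.Ventures.LatticeQCDFlow.TrivializingMaps

open scoped ComplexConjugate Matrix Matrix.Norms.Frobenius InnerProductSpace ContDiff NNReal ENNReal Topology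
open Literature.MathematicalPhysics.QuantumFieldTheory
open Literature.MathematicalPhysics.QuantumFieldTheory.Luscher2010
open SlotRepresentation SlotCoefficient SlotHilbert RankOne Vertex

namespace AnalyticSeries

variable {d L n : ℕ} [NeZero L]

/-! ## §4. The slot count of the generations: `|σ_k| = 4(k+1)` -/

open GradedSeries in
/-- `|σ_k| = 4(k+1)`: one four-slot plaquette system is tensored in per generation. [ours] -/
theorem card_pack_σ (B : SuBasis n) : ∀ k : ℕ, Fintype.card (pack (d := d) (L := L) B k).σ = 4 * (k + 1)
  | 0 => by
      have h : Fintype.card (pack (d := d) (L := L) B 0).σ = Fintype.card (Fin 4) :=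
        Fintype.card_congr (Equiv.refl _)
      rw [h, Fintype.card_fin]
  | k + 1 => by
      have h : Fintype.card (pack (d := d) (L := L) B (k + 1)).σ =
          Fintype.card (Fin 4 ⊕ (pack (d := d) (L := L) B k).σ) := Fintype.card_congr (Equiv.refl _)
      rw [h, Fintype.card_sum, Fintype.card_fin, card_pack_σ B k]
      ring

open GradedSeries in
/-- The degree of the order-`k` form: `|Fin k ⊕ σ_k| = 5k + 4`. [ours] -/
theorem card_index (B : SuBasis n) (k : ℕ) :
    Fintype.card (Fin k ⊕ (pack (d := d) (L := L) B k).σ) = 5 * k + 4 := by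
  rw [Fintype.card_sum, Fintype.card_fin, card_pack_σ B k]
  ring

/-! ## §5. The power series in the phase-space variable and its radius -/

open GradedSeries

/-- **The series as a formal power series** in `q = (t, V)`: degree `5k+4` carries the order-`k` form of the
`k`-th generation (re-indexed to `Fin (5k+4)`), all other degrees are `0`. [ours] -/
def fps (B : SuBasis n) (β : ℝ) : FormalMultilinearSeries ℝ (PhaseP d L n) ℝ := fun m =>
  if h : m % 5 = 4 then
    (Gen.cmm (pack (d := d) (L := L) B (m / 5)).G (m / 5) β).domDomCongr
      (Fintype.equivFinOfCardEq ((card_index (d := d) (L := L) B (m / 5)).trans (by omega)))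
  else 0

/-- **The summed series as a function on the coordinate phase space**:
`q = (t, V) ↦ ∑_k t^k β^{k+1} S̃^{(k)}(V)`. [ours] -/
def series (B : SuBasis n) (β : ℝ) (q : PhaseP d L n) : ℝ :=
  ∑' k, q.1 ^ k * (β ^ (k + 1) * gradedSk (d := d) (L := L) B k (toAmb q.2))

/-- Diagonal values of the formal power series. [ours] -/
theorem fps_apply_const (B : SuBasis n) (β : ℝ) (m : ℕ) (q : PhaseP d L n) :
    fps (d := d) (L := L) B β m (fun _ => q) =
      if m % 5 = 4 then q.1 ^ (m / 5) * (β ^ (m / 5 + 1) * gradedSk (d := d) (L := L) B (m / 5) (toAmb q.2))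
      else 0 := by
  unfold fps
  split_ifs with h
  · rw [ContinuousMultilinearMap.domDomCongr_apply, Gen.cmm_apply_const]
    rfl
  · rfl

/-- In degree `5k+4` the series carries the order-`k` term. [ours] -/
theorem fps_apply_const_deg (B : SuBasis n) (β : ℝ) (k : ℕ) (q : PhaseP d L n) :
    fps (d := d) (L := L) B β (5 * k + 4) (fun _ => q) =
      q.1 ^ k * (β ^ (k + 1) * gradedSk (d := d) (L := L) B k (toAmb q.2)) := by
  rw [fps_apply_const, if_pos (by omega)]
  have hk : (5 * k + 4) / 5 = k := by omega
  rw [hk]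

/-- Norms of the formal power series: `‖fps m‖ = ‖cmm‖` in degree `5k+4`, else `0`. [ours] -/
theorem norm_fps_le (hn : n ≠ 0) (B : SuBasis n) (β : ℝ) (m : ℕ) :
    ‖fps (d := d) (L := L) B β m‖ ≤
      if m % 5 = 4 then |β| ^ (m / 5 + 1) * ((n : ℝ) ^ 8) ^ (m / 5 + 1) *
        ((Real.sqrt ((n : ℝ) / 4))⁻¹ * (Fintype.card (Edge d L) : ℝ) * (N0 d n * theta1 d n B ^ (m / 5)))
      else 0 := by
  unfold fps
  split_ifs with h
  · rw [ContinuousMultilinearMap.norm_domDomCongr]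
    set k := m / 5 with hk
    refine (Gen.norm_cmm_le _ k β).trans ?_
    rw [card_pack_σ B k]
    have hpow : ((n : ℝ) ^ (4 * (k + 1))) ^ 2 = ((n : ℝ) ^ 8) ^ (k + 1) := by
      rw [← pow_mul, ← pow_mul]; congr 1; ring
    rw [hpow]
    refine mul_le_mul_of_nonneg_left ?_ (by positivity)
    refine (Gen.sum_nu_le (pack (d := d) (L := L) B k).G hn (pack_z_eq_zero B k)).trans ?_
    rw [mul_assoc]
    refine mul_le_mul_of_nonneg_left ?_ (inv_nonneg.2 (Real.sqrt_nonneg _))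
    refine (Finset.sum_le_sum fun e _ => mass_pack_le B hn k e).trans (le_of_eq ?_)
    rw [Finset.sum_const, Finset.card_univ, nsmul_eq_mul]
  · rw [norm_zero]

/-- **The radius of the formal power series is at least `3`** as soon as `|β| n^8 θ₁ 3^5 ≤ 1` (the bound
`‖fps m‖ 3^m ≤ |β| n^8 · 81 · (n/4)^{-1/2} #E N₀` is uniform in `m`). [ours] -/
theorem le_radius_fps (hn : n ≠ 0) (B : SuBasis n) {β : ℝ}
    (hβ : |β| * ((n : ℝ) ^ 8 * theta1 d n B * 3 ^ 5) ≤ 1) :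
    ((3 : ℝ≥0) : ℝ≥0∞) ≤ (fps (d := d) (L := L) B β).radius := by
  set A : ℝ := (Real.sqrt ((n : ℝ) / 4))⁻¹ * (Fintype.card (Edge d L) : ℝ) * N0 d n with hA
  have hA0 : 0 ≤ A := by rw [hA]; exact mul_nonneg (by positivity) (N0_nonneg d n)
  have hθ : 0 ≤ theta1 d n B := zero_le_one.trans (one_le_theta1 d n B)
  refine FormalMultilinearSeries.le_radius_of_bound _ (|β| * (n : ℝ) ^ 8 * 3 ^ 4 * A) fun m => ?_
  refine (mul_le_mul_of_nonneg_right (norm_fps_le hn B β m) (by positivity)).trans ?_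
  split_ifs with h
  · set k := m / 5 with hk
    have hm : m = 5 * k + 4 := by omega
    have hq : |β| * (n : ℝ) ^ 8 * theta1 d n B * 3 ^ 5 ≤ 1 := by linarith
    have hq0 : 0 ≤ |β| * (n : ℝ) ^ 8 * theta1 d n B * 3 ^ 5 := by positivity
    rw [hm]
    push_cast
    have hexp : |β| ^ (k + 1) * ((n : ℝ) ^ 8) ^ (k + 1) *
        ((Real.sqrt ((n : ℝ) / 4))⁻¹ * (Fintype.card (Edge d L) : ℝ) * (N0 d n * theta1 d n B ^ k)) *
          (3 : ℝ) ^ (5 * k + 4) =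
        (|β| * (n : ℝ) ^ 8 * 3 ^ 4 * A) * (|β| * (n : ℝ) ^ 8 * theta1 d n B * 3 ^ 5) ^ k := by
      rw [hA, pow_add (3 : ℝ) (5 * k) 4, pow_mul]; ring
    rw [hexp]
    exact mul_le_of_le_one_right (by positivity) (pow_le_one₀ hq0 hq)
  · rw [zero_mul]; positivity

/-- **The series has the formal power series `fps` on the ball `‖q‖ < 3`** (`|β| n^8 θ₁ 3^5 ≤ 1`):
`HasFPowerSeriesOnBall series fps 0 3`. [ours] -/
theorem hasFPowerSeriesOnBall_series (hn : n ≠ 0) (B : SuBasis n) {β : ℝ}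
    (hβ : |β| * ((n : ℝ) ^ 8 * theta1 d n B * 3 ^ 5) ≤ 1) :
    HasFPowerSeriesOnBall (series (d := d) (L := L) B β) (fps (d := d) (L := L) B β) 0 ((3 : ℝ≥0) : ℝ≥0∞) := by
  refine ⟨le_radius_fps hn B hβ, by simp, fun {q} hq => ?_⟩
  rw [Metric.eball_coe, mem_ball_zero_iff] at hq
  have hq' : ‖q‖ < 3 := by exact_mod_cast hq
  rw [zero_add]
  -- the terms in degree `5k+4`, all others vanish
  have hsupp : ∀ m ∉ Set.range (fun k : ℕ => 5 * k + 4), fps (d := d) (L := L) B β m (fun _ => q) = 0 := by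
    intro m hm
    rw [fps_apply_const, if_neg]
    intro h
    exact hm ⟨m / 5, by show 5 * (m / 5) + 4 = m; omega⟩
  have hinj : Function.Injective (fun k : ℕ => 5 * k + 4) := fun a b h => by simpa using h
  rw [← hinj.hasSum_iff hsupp]
  have hcomp : ((fun m => fps (d := d) (L := L) B β m (fun _ => q)) ∘ fun k : ℕ => 5 * k + 4) =
      fun k => q.1 ^ k * (β ^ (k + 1) * gradedSk (d := d) (L := L) B k (toAmb q.2)) := by
    funext k
    exact fps_apply_const_deg B β k q
  rw [hcomp]
  -- summability from the norm bound: `|term_k| ≤ ‖fps (5k+4)‖ ‖q‖^{5k+4}`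
  have hθ : 0 ≤ theta1 d n B := zero_le_one.trans (one_le_theta1 d n B)
  set A : ℝ := (Real.sqrt ((n : ℝ) / 4))⁻¹ * (Fintype.card (Edge d L) : ℝ) * N0 d n with hA
  set ρq : ℝ := |β| * (n : ℝ) ^ 8 * theta1 d n B * ‖q‖ ^ 5 with hρq
  have hρq0 : 0 ≤ ρq := by positivity
  have hρq1 : ρq < 1 := by
    by_cases hz : |β| * (n : ℝ) ^ 8 * theta1 d n B = 0
    · rw [hρq, hz, zero_mul]; exact zero_lt_one
    · have hpos : 0 < |β| * (n : ℝ) ^ 8 * theta1 d n B := lt_of_le_of_ne (by positivity) (Ne.symm hz)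
      have h5 : ‖q‖ ^ 5 < (3 : ℝ) ^ 5 := pow_lt_pow_left₀ hq' (norm_nonneg _) (by norm_num)
      calc ρq < |β| * (n : ℝ) ^ 8 * theta1 d n B * 3 ^ 5 := mul_lt_mul_of_pos_left h5 hpos
        _ ≤ 1 := by linarith
  have hbound : ∀ k, ‖q.1 ^ k * (β ^ (k + 1) * gradedSk (d := d) (L := L) B k (toAmb q.2))‖ ≤
      (|β| * (n : ℝ) ^ 8 * A * ‖q‖ ^ 4) * ρq ^ k := by
    intro k
    rw [← fps_apply_const_deg B β k q]
    refine (ContinuousMultilinearMap.le_opNorm _ _).trans ?_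
    rw [Finset.prod_const, Finset.card_univ, Fintype.card_fin]
    refine (mul_le_mul_of_nonneg_right (norm_fps_le hn B β _) (by positivity)).trans ?_
    rw [if_pos (by omega), show (5 * k + 4) / 5 = k by omega]
    have hexp : |β| ^ (k + 1) * ((n : ℝ) ^ 8) ^ (k + 1) *
        ((Real.sqrt ((n : ℝ) / 4))⁻¹ * (Fintype.card (Edge d L) : ℝ) * (N0 d n * theta1 d n B ^ k)) *
          ‖q‖ ^ (5 * k + 4) = (|β| * (n : ℝ) ^ 8 * A * ‖q‖ ^ 4) * ρq ^ k := by
      rw [hA, hρq, pow_add ‖q‖ (5 * k) 4, pow_mul]; ring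
    rw [hexp]
  have hs : Summable fun k => q.1 ^ k * (β ^ (k + 1) * gradedSk (d := d) (L := L) B k (toAmb q.2)) :=
    Summable.of_norm_bounded ((summable_geometric_of_lt_one hρq0 hρq1).mul_left _) hbound
  exact hs.hasSum

/-- **The summed series is `C^∞` on the ball `‖q‖ < 3`** (real-analytic there). [ours] -/
theorem contDiffOn_series (hn : n ≠ 0) (B : SuBasis n) {β : ℝ}
    (hβ : |β| * ((n : ℝ) ^ 8 * theta1 d n B * 3 ^ 5) ≤ 1) :
    ContDiffOn ℝ ∞ (series (d := d) (L := L) B β) (Metric.ball 0 3) := by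
  intro q hq
  have hq' : q ∈ Metric.eball (0 : PhaseP d L n) ((3 : ℝ≥0) : ℝ≥0∞) := by
    rw [Metric.eball_coe]; exact_mod_cast hq
  exact ((hasFPowerSeriesOnBall_series hn B hβ).analyticAt_of_mem hq').contDiffAt.contDiffWithinAt

/-! ## §6. A global smooth version: the bump -/

/-- The bump on the coordinate phase space: `1` on `‖q‖ ≤ 2`, supported in `‖q‖ < 5/2`. [ours] -/
def bump : ContDiffBump (0 : PhaseP d L n) := ⟨2, 5 / 2, by norm_num, by norm_num⟩

/-- **The smoothed series** `q ↦ bump(q) · series(q)` on the coordinate phase space. [ours] -/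
def smoothSeries (B : SuBasis n) (β : ℝ) (q : PhaseP d L n) : ℝ :=
  (bump : ContDiffBump (0 : PhaseP d L n)) q * series (d := d) (L := L) B β q

/-- The smoothed series is `C^∞` on the whole coordinate phase space. [ours] -/
theorem contDiff_smoothSeries (hn : n ≠ 0) (B : SuBasis n) {β : ℝ}
    (hβ : |β| * ((n : ℝ) ^ 8 * theta1 d n B * 3 ^ 5) ≤ 1) :
    ContDiff ℝ ∞ (smoothSeries (d := d) (L := L) B β) := by
  refine contDiff_iff_contDiffAt.2 fun q => ?_
  by_cases hq : ‖q‖ < 3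
  · have hmem : Metric.ball (0 : PhaseP d L n) 3 ∈ 𝓝 q := Metric.isOpen_ball.mem_nhds (mem_ball_zero_iff.2 hq)
    exact ((bump : ContDiffBump (0 : PhaseP d L n)).contDiff.contDiffAt).mul
      ((contDiffOn_series hn B hβ).contDiffAt hmem)
  · have hfar : ∀ᶠ q' in 𝓝 q, smoothSeries (d := d) (L := L) B β q' = 0 := by
      have hopen : IsOpen {q' : PhaseP d L n | (5 / 2 : ℝ) < ‖q'‖} := isOpen_lt continuous_const continuous_norm
      filter_upwards [hopen.mem_nhds (show (5 / 2 : ℝ) < ‖q‖ by linarith [not_lt.1 hq])] with q' hq'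
      rw [smoothSeries, ContDiffBump.zero_of_le_dist, zero_mul]
      rw [dist_zero_right]
      exact le_of_lt hq'
    exact (contDiffAt_const (c := (0 : ℝ))).congr_of_eventuallyEq hfar

/-- Inside `‖q‖ ≤ 2` the smoothed series is the series. [ours] -/
theorem smoothSeries_eq_series (B : SuBasis n) (β : ℝ) {q : PhaseP d L n} (hq : ‖q‖ ≤ 2) :
    smoothSeries (d := d) (L := L) B β q = series (d := d) (L := L) B β q := by
  rw [smoothSeries, ContDiffBump.one_of_mem_closedBall, one_mul]
  rw [Metric.mem_closedBall, dist_zero_right]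
  exact hq

/-! ## §7. Back to the ambient space `ℝ × M_n(ℂ)^E` -/

omit [NeZero L] in
/-- An entry is bounded by the Frobenius norm. [folklore] -/
theorem norm_entry_le_frobenius (A : Matrix (Fin n) (Fin n) ℂ) (i j : Fin n) : ‖A i j‖ ≤ ‖A‖ := by
  rw [Matrix.frobenius_norm_def]
  have h1 : ‖A i j‖ = (‖A i j‖ ^ (2 : ℝ)) ^ (1 / 2 : ℝ) := by
    rw [← Real.rpow_mul (norm_nonneg _)]; norm_num
  rw [h1]
  refine Real.rpow_le_rpow (by positivity) ?_ (by norm_num)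
  calc ‖A i j‖ ^ (2 : ℝ) ≤ ∑ j', ‖A i j'‖ ^ (2 : ℝ) :=
        Finset.single_le_sum (f := fun j' => ‖A i j'‖ ^ (2 : ℝ)) (fun _ _ => by positivity)
          (Finset.mem_univ j)
    _ ≤ ∑ i', ∑ j', ‖A i' j'‖ ^ (2 : ℝ) :=
        Finset.single_le_sum (f := fun i' => ∑ j', ‖A i' j'‖ ^ (2 : ℝ)) (fun _ _ => by positivity)
          (Finset.mem_univ i)

/-- **The entrywise embedding** `(t, W) ↦ (t, (W(e)_{ij}))` of the ambient phase space (Frobenius norms)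
into the coordinate phase space (sup norms): a continuous linear map of norm `≤ 1`. [ours] -/
def toPhaseP : (ℝ × AmbConfig d L n) →L[ℝ] PhaseP d L n :=
  LinearMap.mkContinuous
    { toFun := fun p => (p.1, fun e i j => p.2 e i j)
      map_add' := fun p p' => rfl
      map_smul' := fun r p => rfl }
    1 fun p => by
      rw [one_mul, Prod.norm_def]
      refine max_le (norm_fst_le p) ?_
      refine (pi_norm_le_iff_of_nonneg (norm_nonneg p)).2 fun e => ?_
      refine (pi_norm_le_iff_of_nonneg (norm_nonneg p)).2 fun i => ?_
      refine (pi_norm_le_iff_of_nonneg (norm_nonneg p)).2 fun j => ?_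
      exact (norm_entry_le_frobenius (p.2 e) i j).trans ((norm_le_pi_norm p.2 e).trans (norm_snd_le p))

/-- Value of the embedding. [ours] -/
@[simp] theorem toPhaseP_apply (p : ℝ × AmbConfig d L n) :
    toPhaseP p = (p.1, fun e i j => p.2 e i j) := rfl

omit [NeZero L] in
/-- `toAmb` undoes the entrywise embedding. [ours] -/
@[simp] theorem toAmb_entries (W : AmbConfig d L n) : toAmb (fun e i j => W e i j) = W := rfl

/-- **The flow action** `S̃_t(W)`: the smoothed summed series read through the entrywise embedding —
a global `C^∞` function on `ℝ × M_n(ℂ)^E` equal to `∑_k t^k β^{k+1} S̃^{(k)}(W)` for `|t| ≤ 2` on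
`SU(n)^E`. [ours] -/
def flowAction (B : SuBasis n) (β : ℝ) (t : ℝ) (W : AmbConfig d L n) : ℝ :=
  smoothSeries (d := d) (L := L) B β (toPhaseP (t, W))

/-- **Joint smoothness of the flow action** on `ℝ × M_n(ℂ)^E` (`|β| n^8 θ₁ 3^5 ≤ 1`). [ours] -/
theorem contDiff_flowAction (hn : n ≠ 0) (B : SuBasis n) {β : ℝ}
    (hβ : |β| * ((n : ℝ) ^ 8 * theta1 d n B * 3 ^ 5) ≤ 1) :
    ContDiff ℝ ∞ fun p : ℝ × AmbConfig d L n => flowAction (d := d) (L := L) B β p.1 p.2 := by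
  have h : (fun p : ℝ × AmbConfig d L n => flowAction (d := d) (L := L) B β p.1 p.2) =
      smoothSeries (d := d) (L := L) B β ∘ toPhaseP := by
    funext p; rfl
  rw [h]
  exact (contDiff_smoothSeries hn B hβ).comp (toPhaseP (d := d) (L := L) (n := n)).contDiff

/-- Points `(t, ιU)` with `|t| ≤ 2` embed into the ball `‖q‖ ≤ 2` (entries of unitary matrices have
modulus `≤ 1`). [ours] -/
theorem norm_toPhaseP_coeConfig_le {t : ℝ} (ht : |t| ≤ 2)
    (U : GaugeConfig d L (Matrix.specialUnitaryGroup (Fin n) ℂ)) :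
    ‖toPhaseP (t, WilsonFlow.coeConfig U)‖ ≤ 2 := by
  rw [toPhaseP_apply, Prod.norm_def]
  refine max_le (by simpa using ht) ?_
  refine (pi_norm_le_iff_of_nonneg zero_le_two).2 fun e => ?_
  refine (pi_norm_le_iff_of_nonneg zero_le_two).2 fun i => ?_
  refine (pi_norm_le_iff_of_nonneg zero_le_two).2 fun j => ?_
  exact (entry_norm_bound_of_unitary (coeConfig_mem_unitaryGroup U e) i j).trans one_le_two

/-- **On `[-2,2] × SU(n)^E` the flow action IS the summed Lüscher series**
`∑_k t^k β^{k+1} S̃^{(k)}(ιU)` (as a `tsum`; it converges for `|t||β| < θ₁⁻¹`, `WilsonFlowActionSeries`).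
[ours] -/
theorem flowAction_coeConfig (B : SuBasis n) (β : ℝ) {t : ℝ} (ht : |t| ≤ 2)
    (U : GaugeConfig d L (Matrix.specialUnitaryGroup (Fin n) ℂ)) :
    flowAction (d := d) (L := L) B β t (WilsonFlow.coeConfig U) =
      ∑' k, t ^ k * (β ^ (k + 1) * gradedSk (d := d) (L := L) B k (WilsonFlow.coeConfig U)) := by
  rw [flowAction, smoothSeries_eq_series B β (norm_toPhaseP_coeConfig_le ht U)]
  rfl

end AnalyticSeries

end Summit.Ventures.LatticeQCDFlow.TrivializingMaps

end
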